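import Summits.MatrixMultiplication.MatrixMultiplication.Theorems.SoloInformedValPerfectBlock

/-!
# SoloInformedValBlockStability — a complete block of volume `v` leaves room for at most `|G| - v` new edges

Sequel of `SoloInformedValPerfectBlock` (same notation: potentials `x, y, z`, pair graphs `H_IJ, H_JK, H_KI`,
no accidental solutions `NoAccidental`, triangles `IsTriangle`; K. Pratt, arXiv:2309.03878, Def. 3.2 for the
ambient notion).  There a PERFECT block (`|I₀||J₀||K₀| = |G|`) was shown to be rigid.  Here is the
quantitative version for an arbitrary COMPLETE block `I₀ × J₀ × K₀` of volume `v = |I₀| · |J₀| · |K₀|`.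

Call an edge TRIANGLE-SUPPORTING if it lies on a triangle, and NEW if it is not an edge of the block.
* `NoAccidental.card_newEdgesIJ_add_le`: for every finite set `E` of new triangle-supporting edges of `H_IJ`
  (edges `(i,j)` on a triangle with `¬ (i ∈ I₀ ∧ j ∈ J₀)`), `#E + v ≤ |G|` (provided `K₀ ≠ ∅`);
* `NoAccidental.card_newEdgesJK_add_le`, `NoAccidental.card_newEdgesKI_add_le`: the same for `H_JK`
  (given `I₀ ≠ ∅`) and `H_KI` (given `J₀ ≠ ∅`).
So a block of volume `|G| - r` admits at most `r` new triangle-supporting edges in each pair graph; for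
`r = 0` this is the rigidity theorem again (`NoAccidental.no_newEdgeIJ_of_perfectBlock`).

PROOF.  Labels are injective on triangle-supporting edges (`NoAccidental.labelA_injOn` etc.: a coincidence
`x i - y j = x i' - y j'` together with a triangle through `(i',j')` is an accidental solution).  The label
of a new edge `(i,j)` avoids the translate `φ₁(block) + z k₀` of the image of the block under
`φ₁ = x - y - z` (`NoAccidental.labelA_not_mem`: `x i - y j = φ₁(i',j',k') + z k₀` reads
`(x i - y j) + (y j' - z k₀) + (z k' - x i') = 0`, an accidental solution forcing `i = i' ∈ I₀`,
`j = j' ∈ J₀`); for `H_JK` one uses `x i₀ - φ₂(block)` with `φ₂ = x - y + z`, for `H_KI`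
`y j₀ - φ₃(block)` with `φ₃ = x + y - z`; all three maps are injective on the block
(`SoloInformedValPerfectBlock`), so the avoided set has `v` elements, and two disjoint subsets of `G` have
at most `|G|` elements together (`card_add_card_le_of_forall_not_mem`).

solo-informed MatrixMultiplication, gen 76 (dossier `paper/val-superlinear.md` (15.7)(i)).  Elementary; no
`sorry`, no new definitions.
-/

namespace Summit.MatrixMultiplication.MatrixMultiplication.Theorems.SoloVal

open Finset

section Counting2

/-- Two disjoint finite subsets of a finite type: if `lab` is injective on `E` and misses `M`, then
`#E + #M ≤ |G|`. -/
theorem card_add_card_le_of_forall_not_mem {α M : Type*} [Fintype M] [DecidableEq M]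
    (E : Finset α) (lab : α → M) (hinj : Set.InjOn lab ↑E) (S : Finset M)
    (hmiss : ∀ e ∈ E, lab e ∉ S) : E.card + S.card ≤ Fintype.card M := by
  have hdisj : Disjoint (E.image lab) S := by
    rw [Finset.disjoint_left]
    intro g hg hgS
    obtain ⟨e, he, rfl⟩ := Finset.mem_image.mp hg
    exact hmiss e he hgS
  calc E.card + S.card = (E.image lab ∪ S).card := by
        rw [Finset.card_union_of_disjoint hdisj, Finset.card_image_of_injOn hinj]
    _ ≤ Fintype.card M := Finset.card_le_univ _

end Counting2

section Stability

variable {G : Type*} [AddCommGroup G]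
variable {I J K : Type*}
variable {x : I → G} {y : J → G} {z : K → G}
variable {HIJ : Finset (I × J)} {HJK : Finset (J × K)} {HKI : Finset (K × I)}
variable {I₀ : Finset I} {J₀ : Finset J} {K₀ : Finset K}

/-- The third sign pattern `x i + y j - z k` is injective on a complete block too (swap `j` and `j'`). -/
theorem NoAccidental.block_inj'' (hN : NoAccidental x y z HIJ HJK HKI)
    (hIJ : ∀ i ∈ I₀, ∀ j ∈ J₀, (i, j) ∈ HIJ) (hJK : ∀ j ∈ J₀, ∀ k ∈ K₀, (j, k) ∈ HJK)
    (hKI : ∀ k ∈ K₀, ∀ i ∈ I₀, (k, i) ∈ HKI)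
    {i i' : I} {j j' : J} {k k' : K} (hi : i ∈ I₀) (hi' : i' ∈ I₀) (hj : j ∈ J₀) (hj' : j' ∈ J₀)
    (hk : k ∈ K₀) (hk' : k' ∈ K₀) (h : x i + y j - z k = x i' + y j' - z k') :
    i = i' ∧ j = j' ∧ k = k' := by
  have h' : x i - y j' - z k = x i' - y j - z k' := by
    have e : x i - y j' - z k = (x i + y j - z k) - y j - y j' := by abel
    rw [e, h]; abel
  obtain ⟨hii, hjj, hkk⟩ := hN.block_inj hIJ hJK hKI hi hi' hj' hj hk hk' h'
  exact ⟨hii, hjj.symm, hkk⟩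

/-- `A`-labels are injective on triangle-supporting edges of `H_IJ`. -/
theorem NoAccidental.labelA_injOn (hN : NoAccidental x y z HIJ HJK HKI) (E : Finset (I × J))
    (hE : ∀ e ∈ E, ∃ k, IsTriangle HIJ HJK HKI (e.1, e.2, k)) :
    Set.InjOn (fun e : I × J => x e.1 - y e.2) ↑E := by
  rintro ⟨i, j⟩ he ⟨i', j'⟩ he' h
  rw [Finset.mem_coe] at he he'
  obtain ⟨k₁, g1, -, -⟩ := hE _ he
  obtain ⟨k', -, h2, h3⟩ := hE _ he'
  simp only at h g1 h2 h3
  have hsum : (x i - y j) + (y j' - z k') + (z k' - x i') = 0 := by rw [h]; abel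
  obtain ⟨rfl, rfl, -⟩ := hN i j j' k' k' i' g1 h2 h3 hsum
  rfl

/-- `B`-labels are injective on triangle-supporting edges of `H_JK`. -/
theorem NoAccidental.labelB_injOn (hN : NoAccidental x y z HIJ HJK HKI) (E : Finset (J × K))
    (hE : ∀ e ∈ E, ∃ i, IsTriangle HIJ HJK HKI (i, e.1, e.2)) :
    Set.InjOn (fun e : J × K => y e.1 - z e.2) ↑E := by
  rintro ⟨j, k⟩ he ⟨j', k'⟩ he' h
  rw [Finset.mem_coe] at he he'
  obtain ⟨i, g1, -, g3⟩ := hE _ he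
  obtain ⟨i', -, h2, -⟩ := hE _ he'
  simp only at h g1 g3 h2
  have hsum : (x i - y j) + (y j' - z k') + (z k - x i) = 0 := by
    have e : (x i - y j) + (y j' - z k') + (z k - x i) = (y j' - z k') - (y j - z k) := by abel
    rw [e, h]; exact sub_self _
  obtain ⟨-, rfl, hkk⟩ := hN i j j' k' k i g1 h2 g3 hsum
  rw [hkk]

/-- `C`-labels are injective on triangle-supporting edges of `H_KI`. -/
theorem NoAccidental.labelC_injOn (hN : NoAccidental x y z HIJ HJK HKI) (E : Finset (K × I))
    (hE : ∀ e ∈ E, ∃ j, IsTriangle HIJ HJK HKI (e.2, j, e.1)) :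
    Set.InjOn (fun e : K × I => z e.1 - x e.2) ↑E := by
  rintro ⟨k, i⟩ he ⟨k', i'⟩ he' h
  rw [Finset.mem_coe] at he he'
  obtain ⟨j, g1, g2, -⟩ := hE _ he
  obtain ⟨j', -, -, h3⟩ := hE _ he'
  simp only at h g1 g2 h3
  have hsum : (x i - y j) + (y j - z k) + (z k' - x i') = 0 := by
    have e : (x i - y j) + (y j - z k) + (z k' - x i') = (z k' - x i') - (z k - x i) := by abel
    rw [e, h]; exact sub_self _
  obtain ⟨hii, -, hkk⟩ := hN i j j k k' i' g1 g2 h3 hsum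
  rw [hii, hkk]

/-- The `A`-label of a NEW triangle-supporting edge `(i,j)` (not both ends in the block) avoids
`φ₁(block) + z k₀`. -/
theorem NoAccidental.labelA_not_mem [DecidableEq G] (hN : NoAccidental x y z HIJ HJK HKI)
    (hJK : ∀ j ∈ J₀, ∀ k ∈ K₀, (j, k) ∈ HJK) (hKI : ∀ k ∈ K₀, ∀ i ∈ I₀, (k, i) ∈ HKI)
    {k₀ : K} (hk₀ : k₀ ∈ K₀) {i : I} {j : J} (hij : (i, j) ∈ HIJ) (hnew : ¬ (i ∈ I₀ ∧ j ∈ J₀)) :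
    x i - y j ∉ (I₀ ×ˢ (J₀ ×ˢ K₀)).image (fun τ => phi x y z τ + z k₀) := by
  intro hmem
  obtain ⟨⟨i', j', k'⟩, hτ, hEq⟩ := Finset.mem_image.mp hmem
  simp only [Finset.mem_product] at hτ
  obtain ⟨hi', hj', hk'⟩ := hτ
  simp only [phi] at hEq
  have hsum : (x i - y j) + (y j' - z k₀) + (z k' - x i') = 0 := by rw [← hEq]; abel
  obtain ⟨rfl, rfl, -⟩ := hN i j j' k₀ k' i' hij (hJK j' hj' k₀ hk₀) (hKI k' hk' i' hi') hsum
  exact hnew ⟨hi', hj'⟩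

/-- The `B`-label of a new triangle-supporting edge `(j,k)` avoids `x i₀ - φ₂(block)`, `φ₂ = x - y + z`. -/
theorem NoAccidental.labelB_not_mem [DecidableEq G] (hN : NoAccidental x y z HIJ HJK HKI)
    (hIJ : ∀ i ∈ I₀, ∀ j ∈ J₀, (i, j) ∈ HIJ) (hKI : ∀ k ∈ K₀, ∀ i ∈ I₀, (k, i) ∈ HKI)
    {i₀ : I} (hi₀ : i₀ ∈ I₀) {j : J} {k : K} (hjk : (j, k) ∈ HJK) (hnew : ¬ (j ∈ J₀ ∧ k ∈ K₀)) :
    y j - z k ∉ (I₀ ×ˢ (J₀ ×ˢ K₀)).image (fun τ => x i₀ - (x τ.1 - y τ.2.1 + z τ.2.2)) := by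
  intro hmem
  obtain ⟨⟨i₁, j₁, k₁⟩, hτ, hEq⟩ := Finset.mem_image.mp hmem
  simp only [Finset.mem_product] at hτ
  obtain ⟨hi₁, hj₁, hk₁⟩ := hτ
  simp only at hEq
  have hsum : (x i₁ - y j₁) + (y j - z k) + (z k₁ - x i₀) = 0 := by rw [← hEq]; abel
  obtain ⟨-, rfl, hkk⟩ := hN i₁ j₁ j k k₁ i₀ (hIJ i₁ hi₁ j₁ hj₁) hjk (hKI k₁ hk₁ i₀ hi₀) hsum
  exact hnew ⟨hj₁, hkk ▸ hk₁⟩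

/-- The `C`-label of a new triangle-supporting edge `(k,i)` avoids `y j₀ - φ₃(block)`, `φ₃ = x + y - z`. -/
theorem NoAccidental.labelC_not_mem [DecidableEq G] (hN : NoAccidental x y z HIJ HJK HKI)
    (hIJ : ∀ i ∈ I₀, ∀ j ∈ J₀, (i, j) ∈ HIJ) (hJK : ∀ j ∈ J₀, ∀ k ∈ K₀, (j, k) ∈ HJK)
    {j₀ : J} (hj₀ : j₀ ∈ J₀) {k : K} {i : I} (hki : (k, i) ∈ HKI) (hnew : ¬ (k ∈ K₀ ∧ i ∈ I₀)) :
    z k - x i ∉ (I₀ ×ˢ (J₀ ×ˢ K₀)).image (fun τ => y j₀ - (x τ.1 + y τ.2.1 - z τ.2.2)) := by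
  intro hmem
  obtain ⟨⟨i₁, j', k''⟩, hτ, hEq⟩ := Finset.mem_image.mp hmem
  simp only [Finset.mem_product] at hτ
  obtain ⟨hi₁, hj', hk''⟩ := hτ
  simp only at hEq
  have hsum : (x i₁ - y j₀) + (y j' - z k'') + (z k - x i) = 0 := by rw [← hEq]; abel
  obtain ⟨hii, -, hkk⟩ := hN i₁ j₀ j' k'' k i (hIJ i₁ hi₁ j₀ hj₀) (hJK j' hj' k'' hk'') hki hsum
  exact hnew ⟨hkk ▸ hk'', hii ▸ hi₁⟩

/-- STABILITY, `H_IJ`: a set `E` of new triangle-supporting edges of `H_IJ` has `#E + |I₀||J₀||K₀| ≤ |G|`. -/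
theorem NoAccidental.card_newEdgesIJ_add_le [Fintype G] [DecidableEq G]
    (hN : NoAccidental x y z HIJ HJK HKI)
    (hIJ : ∀ i ∈ I₀, ∀ j ∈ J₀, (i, j) ∈ HIJ) (hJK : ∀ j ∈ J₀, ∀ k ∈ K₀, (j, k) ∈ HJK)
    (hKI : ∀ k ∈ K₀, ∀ i ∈ I₀, (k, i) ∈ HKI) (hK₀ : K₀.Nonempty)
    (E : Finset (I × J)) (hE : ∀ e ∈ E, ∃ k, IsTriangle HIJ HJK HKI (e.1, e.2, k))
    (hnew : ∀ e ∈ E, ¬ (e.1 ∈ I₀ ∧ e.2 ∈ J₀)) :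
    E.card + I₀.card * J₀.card * K₀.card ≤ Fintype.card G := by
  obtain ⟨k₀, hk₀⟩ := hK₀
  have hS : ((I₀ ×ˢ (J₀ ×ˢ K₀)).image (fun τ => phi x y z τ + z k₀)).card
      = I₀.card * J₀.card * K₀.card := by
    rw [Finset.card_image_of_injOn, Finset.card_product, Finset.card_product, mul_assoc]
    intro τ hτ τ' hτ' h
    exact hN.phi_injOn_block hIJ hJK hKI hτ hτ' (add_right_cancel h)
  rw [← hS]
  refine card_add_card_le_of_forall_not_mem E (fun e : I × J => x e.1 - y e.2)
    (hN.labelA_injOn E hE) _ ?_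
  rintro ⟨i, j⟩ he
  obtain ⟨k, h1, -, -⟩ := hE _ he
  exact hN.labelA_not_mem hJK hKI hk₀ h1 (hnew _ he)

/-- STABILITY, `H_JK`: a set `E` of new triangle-supporting edges of `H_JK` has `#E + |I₀||J₀||K₀| ≤ |G|`. -/
theorem NoAccidental.card_newEdgesJK_add_le [Fintype G] [DecidableEq G]
    (hN : NoAccidental x y z HIJ HJK HKI)
    (hIJ : ∀ i ∈ I₀, ∀ j ∈ J₀, (i, j) ∈ HIJ) (hJK : ∀ j ∈ J₀, ∀ k ∈ K₀, (j, k) ∈ HJK)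
    (hKI : ∀ k ∈ K₀, ∀ i ∈ I₀, (k, i) ∈ HKI) (hI₀ : I₀.Nonempty)
    (E : Finset (J × K)) (hE : ∀ e ∈ E, ∃ i, IsTriangle HIJ HJK HKI (i, e.1, e.2))
    (hnew : ∀ e ∈ E, ¬ (e.1 ∈ J₀ ∧ e.2 ∈ K₀)) :
    E.card + I₀.card * J₀.card * K₀.card ≤ Fintype.card G := by
  obtain ⟨i₀, hi₀⟩ := hI₀
  have hS : ((I₀ ×ˢ (J₀ ×ˢ K₀)).image (fun τ => x i₀ - (x τ.1 - y τ.2.1 + z τ.2.2))).card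
      = I₀.card * J₀.card * K₀.card := by
    rw [Finset.card_image_of_injOn, Finset.card_product, Finset.card_product, mul_assoc]
    intro τ hτ τ' hτ' h
    exact hN.phi'_injOn_block hIJ hJK hKI hτ hτ' (sub_right_injective h)
  rw [← hS]
  refine card_add_card_le_of_forall_not_mem E (fun e : J × K => y e.1 - z e.2)
    (hN.labelB_injOn E hE) _ ?_
  rintro ⟨j, k⟩ he
  obtain ⟨i, -, h2, -⟩ := hE _ he
  exact hN.labelB_not_mem hIJ hKI hi₀ h2 (hnew _ he)

/-- The third sign pattern `x + y - z` is injective on a complete block (set version). -/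
theorem NoAccidental.phi''_injOn_block (hN : NoAccidental x y z HIJ HJK HKI)
    (hIJ : ∀ i ∈ I₀, ∀ j ∈ J₀, (i, j) ∈ HIJ) (hJK : ∀ j ∈ J₀, ∀ k ∈ K₀, (j, k) ∈ HJK)
    (hKI : ∀ k ∈ K₀, ∀ i ∈ I₀, (k, i) ∈ HKI) :
    Set.InjOn (fun τ : I × J × K => x τ.1 + y τ.2.1 - z τ.2.2) ↑(I₀ ×ˢ (J₀ ×ˢ K₀)) := by
  rintro ⟨i, j, k⟩ hτ ⟨i', j', k'⟩ hτ' h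
  simp only [Finset.coe_product, Set.mem_prod, Finset.mem_coe] at hτ hτ'
  obtain ⟨hi, hj, hk⟩ := hτ
  obtain ⟨hi', hj', hk'⟩ := hτ'
  simp only at h
  obtain ⟨rfl, rfl, rfl⟩ := hN.block_inj'' hIJ hJK hKI hi hi' hj hj' hk hk' h
  rfl

/-- STABILITY, `H_KI`: a set `E` of new triangle-supporting edges of `H_KI` has `#E + |I₀||J₀||K₀| ≤ |G|`. -/
theorem NoAccidental.card_newEdgesKI_add_le [Fintype G] [DecidableEq G]
    (hN : NoAccidental x y z HIJ HJK HKI)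
    (hIJ : ∀ i ∈ I₀, ∀ j ∈ J₀, (i, j) ∈ HIJ) (hJK : ∀ j ∈ J₀, ∀ k ∈ K₀, (j, k) ∈ HJK)
    (hKI : ∀ k ∈ K₀, ∀ i ∈ I₀, (k, i) ∈ HKI) (hJ₀ : J₀.Nonempty)
    (E : Finset (K × I)) (hE : ∀ e ∈ E, ∃ j, IsTriangle HIJ HJK HKI (e.2, j, e.1))
    (hnew : ∀ e ∈ E, ¬ (e.1 ∈ K₀ ∧ e.2 ∈ I₀)) :
    E.card + I₀.card * J₀.card * K₀.card ≤ Fintype.card G := by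
  obtain ⟨j₀, hj₀⟩ := hJ₀
  have hS : ((I₀ ×ˢ (J₀ ×ˢ K₀)).image (fun τ => y j₀ - (x τ.1 + y τ.2.1 - z τ.2.2))).card
      = I₀.card * J₀.card * K₀.card := by
    rw [Finset.card_image_of_injOn, Finset.card_product, Finset.card_product, mul_assoc]
    intro τ hτ τ' hτ' h
    exact hN.phi''_injOn_block hIJ hJK hKI hτ hτ' (sub_right_injective h)
  rw [← hS]
  refine card_add_card_le_of_forall_not_mem E (fun e : K × I => z e.1 - x e.2)
    (hN.labelC_injOn E hE) _ ?_
  rintro ⟨k, i⟩ he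
  obtain ⟨j, -, -, h3⟩ := hE _ he
  exact hN.labelC_not_mem hIJ hJK hj₀ h3 (hnew _ he)

/-- The case `r = 0` recovers rigidity: a perfect block admits no new triangle-supporting edge of `H_IJ`. -/
theorem NoAccidental.no_newEdgeIJ_of_perfectBlock [Fintype G] [DecidableEq G]
    (hN : NoAccidental x y z HIJ HJK HKI)
    (hIJ : ∀ i ∈ I₀, ∀ j ∈ J₀, (i, j) ∈ HIJ) (hJK : ∀ j ∈ J₀, ∀ k ∈ K₀, (j, k) ∈ HJK)
    (hKI : ∀ k ∈ K₀, ∀ i ∈ I₀, (k, i) ∈ HKI) (hK₀ : K₀.Nonempty)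
    (hcard : I₀.card * J₀.card * K₀.card = Fintype.card G)
    {i : I} {j : J} {k : K} (hτ : IsTriangle HIJ HJK HKI (i, j, k)) : i ∈ I₀ ∧ j ∈ J₀ := by
  by_contra hnew
  have h := hN.card_newEdgesIJ_add_le hIJ hJK hKI hK₀ {(i, j)} (fun e he => by
      rw [Finset.mem_singleton] at he; subst he; exact ⟨k, hτ⟩)
    (fun e he => by rw [Finset.mem_singleton] at he; subst he; exact hnew)
  rw [Finset.card_singleton, hcard] at h
  omega

end Stability

end Summit.MatrixMultiplication.MatrixMultiplication.Theorems.SoloVal
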